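import Literature.AnabelianGeometry.SemiGraphs.PullbackFunctor

/-!
# Restriction of a morphism of semi-graphs of anabelioids to sub-semi-graphs — DEFINITIONS

Mochizuki, *Semi-graphs of anabelioids*, Publ. RIMS **42** (2006), §1 p. 12 (sub-semi-graphs and
their inclusion morphisms), Def. 2.1 p. 24 ("the semi-graph of anabelioids `𝒢_ℍ` obtained by
restricting `𝒢` to `ℍ`") and §2 p. 30, proof of Cor. 2.7 (i): for a finite étale covering `𝒢′ → 𝒢`
and a sub-semi-graph `ℍ ⊆ 𝔾`, "whose restriction to `ℍ` we denote by `ℋ′ → ℍ`".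
[cite: MochizukiSemiAnbd2006, Cor. 2.7(i) p.30]

The tree has `SemiGraphOfAnabelioids.restrict 𝒢 H = 𝒢_ℍ`, the restriction functor
`restrictFunctor H : B(𝒢) ⥤ B(𝒢_ℍ)` and `piHToPi` (`GraphOfAnabelioids.lean`), but not yet the
restriction OF A MORPHISM.  This file supplies it, at both levels:

* `SemiGraph.Hom.restrict f K H hV hE : K.toSemiGraph ⟶ H.toSemiGraph` — the restriction of a
  morphism of semi-graphs `f : G′ → G` to sub-semi-graphs `K ⊆ G′`, `H ⊆ G` with `f(K) ⊆ H`;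
* `SemiGraphOfAnabelioids.Hom.restrict φ K H hV hE : Hom (𝒢′|_K) (𝒢|_ℍ)` — the restriction
  `ℋ′ → ℍ` of a morphism of semi-graphs of anabelioids (same constituent functors and 2-cells);
* the compatibility of pull-back with restriction, `(φ^* A)|_K = (φ|_K)^* (A|_ℍ)` on objects
  (`Hom.restrictFunctor_obj_pullbackFunctor_obj`) and as an equality of functors
  (`Hom.pullbackFunctor_comp_restrictFunctor`), and the resulting equality of the induced
  homomorphisms of fundamental groups (`Hom.pi1Map_pullbackFunctor_comp_restrictFunctor`), which is
  what the group-theoretic dictionary ((D3) of `FiniteEtaleCoveringDictionary.lean`: the image of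
  `Π_K → Π_{𝒢′} → Π_𝒢`) consumes.

Definitions and definitional bookkeeping only; no facts are asserted; nothing here takes a side on
[IUTchIII] Cor. 3.12.
-/

namespace Literature.AnabelianGeometry.SemiGraphs

open CategoryTheory
open Literature.AnabelianGeometry.Anabelioids

universe w v₁ u₁ u

/-! ### Semi-graphs: restricting a morphism to sub-semi-graphs -/

namespace SemiGraph

variable {G G' : SemiGraph.{u}}

/-- The restriction `K → H` of a morphism of semi-graphs `f : G′ → G` to sub-semi-graphs `K ⊆ G′`,
`H ⊆ G` with `f(K) ⊆ H` (vertices and edges; the branches of an edge of `K` then go to branches of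
an edge of `H`, and the coincidence maps are respected by conditions (b), (c) of p. 12).
[cite: MochizukiSemiAnbd2006, §1 p.12] -/
noncomputable def Hom.restrict (f : G' ⟶ G) (K : G'.Subgraph) (H : G.Subgraph)
    (hV : K.verts ⊆ f.vertexMap ⁻¹' H.verts) (hE : K.edges ⊆ f.edgeMap ⁻¹' H.edges) :
    K.toSemiGraph ⟶ H.toSemiGraph where
  vertexMap v := ⟨f.vertexMap v.1, hV v.2⟩
  edgeMap e := ⟨f.edgeMap e.1, hE e.2⟩
  branchMap b := ⟨f.branchMap b.1, by
    show G.edgeOf (f.branchMap b.1) ∈ H.edges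
    rw [f.edgeOf_branchMap]
    exact hE b.2⟩
  edgeOf_branchMap b := Subtype.ext (f.edgeOf_branchMap b.1)
  branchMap_injOn b₁ b₂ he h :=
    Subtype.ext (f.branchMap_injOn b₁.1 b₂.1 (congrArg Subtype.val he) (congrArg Subtype.val h))
  abuts_branchMap b v h := by
    have hb : G.abuts (f.branchMap b.1) = some (f.vertexMap v.1) :=
      f.abuts_branchMap b.1 v.1 (K.ι.abuts_branchMap b v h)
    change (G.abuts (f.branchMap b.1)).pbind _ = _
    simp only [hb, Option.pbind_some]
    exact dif_pos (hV v.2)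

/-- Vertices: `(f|_K)(v) = f(v)`. [cite: MochizukiSemiAnbd2006, §1 p.12] -/
@[simp] theorem Hom.restrict_vertexMap_coe (f : G' ⟶ G) (K : G'.Subgraph) (H : G.Subgraph)
    (hV : K.verts ⊆ f.vertexMap ⁻¹' H.verts) (hE : K.edges ⊆ f.edgeMap ⁻¹' H.edges)
    (v : K.toSemiGraph.Vertex) : ((Hom.restrict f K H hV hE).vertexMap v).1 = f.vertexMap v.1 := rfl

/-- Edges: `(f|_K)(e) = f(e)`. [cite: MochizukiSemiAnbd2006, §1 p.12] -/
@[simp] theorem Hom.restrict_edgeMap_coe (f : G' ⟶ G) (K : G'.Subgraph) (H : G.Subgraph)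
    (hV : K.verts ⊆ f.vertexMap ⁻¹' H.verts) (hE : K.edges ⊆ f.edgeMap ⁻¹' H.edges)
    (e : K.toSemiGraph.Edge) : ((Hom.restrict f K H hV hE).edgeMap e).1 = f.edgeMap e.1 := rfl

/-- Branches: `(f|_K)(b) = f(b)`. [cite: MochizukiSemiAnbd2006, §1 p.12] -/
@[simp] theorem Hom.restrict_branchMap_coe (f : G' ⟶ G) (K : G'.Subgraph) (H : G.Subgraph)
    (hV : K.verts ⊆ f.vertexMap ⁻¹' H.verts) (hE : K.edges ⊆ f.edgeMap ⁻¹' H.edges)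
    (b : K.toSemiGraph.Branch) : ((Hom.restrict f K H hV hE).branchMap b).1 = f.branchMap b.1 := rfl

/-- The restriction commutes with the inclusions: `ι_H ∘ f|_K = f ∘ ι_K`.
[cite: MochizukiSemiAnbd2006, §1 p.12] -/
theorem Hom.restrict_comp_ι (f : G' ⟶ G) (K : G'.Subgraph) (H : G.Subgraph)
    (hV : K.verts ⊆ f.vertexMap ⁻¹' H.verts) (hE : K.edges ⊆ f.edgeMap ⁻¹' H.edges) :
    Hom.restrict f K H hV hE ≫ H.ι = K.ι ≫ f := rfl

end SemiGraph

/-! ### Semi-graphs of anabelioids: the restriction `ℋ′ → ℍ` of a morphism -/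

namespace SemiGraphOfAnabelioids

variable {𝒢 𝒢' : SemiGraphOfAnabelioids.{v₁, u₁, u}}

/-- **The restriction `φ|_K : 𝒢′|_K → 𝒢|_ℍ`** of a morphism of semi-graphs of anabelioids
`φ : 𝒢′ → 𝒢` to sub-semi-graphs `K ⊆ 𝔾′`, `ℍ ⊆ 𝔾` with `φ(K) ⊆ ℍ` ([SemiAnbd] p. 30: "whose
restriction to `ℍ` we denote by `ℋ′ → ℍ`"): the restricted morphism of underlying semi-graphs, with
the same constituent morphisms `φ_v`, `φ_e` and the same 2-isomorphisms `φ_b`.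
[cite: MochizukiSemiAnbd2006, Cor. 2.7(i) p.30] -/
noncomputable def Hom.restrict (φ : Hom 𝒢' 𝒢) (K : 𝒢'.graph.Subgraph) (H : 𝒢.graph.Subgraph)
    (hV : K.verts ⊆ φ.base.vertexMap ⁻¹' H.verts) (hE : K.edges ⊆ φ.base.edgeMap ⁻¹' H.edges) :
    Hom (𝒢'.restrict K) (𝒢.restrict H) where
  base := SemiGraph.Hom.restrict φ.base K H hV hE
  φV v := φ.φV v.1
  φE e f p := φ.φE e.1 f.1 (congrArg Subtype.val p)
  φB b v h := φ.φB b.1 v.1 (K.ι.abuts_branchMap b v h)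

namespace Hom

variable (φ : Hom 𝒢' 𝒢) (K : 𝒢'.graph.Subgraph) (H : 𝒢.graph.Subgraph)
  (hV : K.verts ⊆ φ.base.vertexMap ⁻¹' H.verts) (hE : K.edges ⊆ φ.base.edgeMap ⁻¹' H.edges)

/-- The vertex constituents of `φ|_K` are those of `φ`. [cite: MochizukiSemiAnbd2006, Cor. 2.7(i) p.30] -/
@[simp] theorem restrict_φV (v : (𝒢'.restrict K).graph.Vertex) :
    (φ.restrict K H hV hE).φV v = φ.φV v.1 := rfl

/-- The edge constituents of `φ|_K` are those of `φ`. [cite: MochizukiSemiAnbd2006, Cor. 2.7(i) p.30] -/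
@[simp] theorem restrict_φE (e : (𝒢'.restrict K).graph.Edge) (f : (𝒢.restrict H).graph.Edge)
    (p : (φ.restrict K H hV hE).base.edgeMap e = f) :
    (φ.restrict K H hV hE).φE e f p = φ.φE e.1 f.1 (congrArg Subtype.val p) := rfl

/-- The underlying morphism of semi-graphs of `φ|_K` is the restriction of that of `φ`.
[cite: MochizukiSemiAnbd2006, Cor. 2.7(i) p.30] -/
theorem restrict_base : (φ.restrict K H hV hE).base = SemiGraph.Hom.restrict φ.base K H hV hE := rfl

/-- **Pull-back commutes with restriction, on objects:** `(φ^* A)|_K = (φ|_K)^* (A|_ℍ)` in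
`B(𝒢′|_K)` — same vertex and edge objects, same gluing. [cite: MochizukiSemiAnbd2006, Rem. 2.11.1 p.32] -/
theorem restrictFunctor_obj_pullbackFunctor_obj (A : 𝒢.BObj) :
    (𝒢'.restrictFunctor K).obj (φ.pullbackFunctor.obj A) =
      (φ.restrict K H hV hE).pullbackFunctor.obj ((𝒢.restrictFunctor H).obj A) := by
  change SemiGraphOfAnabelioids.BObj.mk _ _ _ = SemiGraphOfAnabelioids.BObj.mk _ _ _
  congr 1
  funext b v h
  ext
  change (φ.gluingIso b.1 v.1 _).hom.app A =
    ((φ.restrict K H hV hE).gluingIso b v h).hom.app ((𝒢.restrictFunctor H).obj A)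
  simp only [gluingIso, reindexIso, Iso.trans_hom, Functor.isoWhiskerLeft_hom,
    Functor.isoWhiskerRight_hom, NatTrans.comp_app, Functor.whiskerLeft_app,
    Functor.whiskerRight_app, eqToIso.hom, eqToHom_app]
  rfl

/-- **Pull-back commutes with restriction:** `φ^* ⋙ (−)|_K = (−)|_ℍ ⋙ (φ|_K)^*` as functors
`B(𝒢) ⥤ B(𝒢′|_K)`. [cite: MochizukiSemiAnbd2006, Rem. 2.11.1 p.32] -/
theorem pullbackFunctor_comp_restrictFunctor :
    φ.pullbackFunctor ⋙ 𝒢'.restrictFunctor K =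
      𝒢.restrictFunctor H ⋙ (φ.restrict K H hV hE).pullbackFunctor := by
  refine CategoryTheory.Functor.ext (fun A => φ.restrictFunctor_obj_pullbackFunctor_obj K H hV hE A)
    (fun A B g => ?_)
  have key : ∀ {X Y X' Y' : (𝒢'.restrict K).BObj} (hX : X = X') (hY : Y = Y') (f : X ⟶ Y)
      (f' : X' ⟶ Y'), (∀ v, HEq (f.fS v) (f'.fS v)) → (∀ e, HEq (f.fT e) (f'.fT e)) →
      f = eqToHom hX ≫ f' ≫ eqToHom hY.symm := by
    intro X Y X' Y' hX hY f f' hS hT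
    subst hX; subst hY
    simp only [eqToHom_refl, Category.comp_id, Category.id_comp]
    exact BObj.hom_ext _ _ (funext fun v => eq_of_heq (hS v)) (funext fun e => eq_of_heq (hT e))
  exact key (φ.restrictFunctor_obj_pullbackFunctor_obj K H hV hE A)
    (φ.restrictFunctor_obj_pullbackFunctor_obj K H hV hE B) _ _ (fun v => HEq.rfl) (fun e => HEq.rfl)

/-- Restriction to `ℍ` followed by restriction to a vertex `w` of `ℍ` is restriction to `w`:
`(−)|_ℍ ⋙ ρ^ℍ_w = ρ_w` (definitional). [cite: MochizukiSemiAnbd2006, Def. 2.1 p.24] -/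
theorem _root_.Literature.AnabelianGeometry.SemiGraphs.SemiGraphOfAnabelioids.restrictFunctor_comp_ρ
    (𝒢 : SemiGraphOfAnabelioids.{v₁, u₁, u}) (H : 𝒢.graph.Subgraph) (w : H.toSemiGraph.Vertex) :
    𝒢.restrictFunctor H ⋙ (𝒢.restrict H).ρ w = 𝒢.ρ w.1 := rfl

/-- The basepoint square of the restriction: `(φ|_K)^* ⋙ ρ^K_w = ρ^ℍ_{φ w} ⋙ φ_w^*` (definitional,
an instance of `pullbackFunctor_comp_ρ`). [cite: MochizukiSemiAnbd2006, Def. 2.1 p.23] -/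
theorem restrict_pullbackFunctor_comp_ρ (w : K.toSemiGraph.Vertex) :
    (φ.restrict K H hV hE).pullbackFunctor ⋙ (𝒢'.restrict K).ρ w =
      (𝒢.restrict H).ρ ⟨φ.base.vertexMap w.1, hV w.2⟩ ⋙ (φ.φV w.1).pullback := rfl

/-- **The induced homomorphisms agree:** for the basepoint of `B(𝒢′|_K)` through a vertex `w` of `K`,
`π₁(φ^* ⋙ (−)|_K) = π₁((−)|_ℍ ⋙ (φ|_K)^*)` as homomorphisms `Π_K → Π_𝒢` — so the image of
`Π_K → Π_{𝒢′} → Π_𝒢` is the image of `Π_K → Π_ℍ → Π_𝒢` ([SemiAnbd] p. 30).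
[cite: MochizukiSemiAnbd2006, Cor. 2.7(i) p.30] -/
theorem pi1Map_pullbackFunctor_comp_restrictFunctor (w : K.toSemiGraph.Vertex)
    (F' : 𝒢'.V w.1 ⥤ FintypeCat.{w}) :
    pi1Map (φ.pullbackFunctor ⋙ 𝒢'.restrictFunctor K) ((𝒢'.restrict K).ρ w ⋙ F') =
      pi1Map (𝒢.restrictFunctor H ⋙ (φ.restrict K H hV hE).pullbackFunctor)
        ((𝒢'.restrict K).ρ w ⋙ F') :=
  eq_of_heq (congr_arg_heq (fun P => pi1Map P ((𝒢'.restrict K).ρ w ⋙ F'))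
    (φ.pullbackFunctor_comp_restrictFunctor K H hV hE))

/-- Hence `Π_K → Π_{𝒢′} → Π_𝒢` factors as `Π_K → Π_ℍ → Π_𝒢`: with `ψ := φ|_K`,
`π₁(φ^*) ∘ π₁((−)|_K) = π₁((−)|_ℍ) ∘ π₁(ψ^*)` at the basepoint through `w ∈ K`.
[cite: MochizukiSemiAnbd2006, Cor. 2.7(i) p.30] -/
theorem pi1Map_pullbackFunctor_comp_piHToPi (w : K.toSemiGraph.Vertex)
    (F' : 𝒢'.V w.1 ⥤ FintypeCat.{w}) :
    (pi1Map φ.pullbackFunctor (𝒢'.ρ w.1 ⋙ F')).comp (𝒢'.piHToPi K w F') =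
      (𝒢.piHToPi H ⟨φ.base.vertexMap w.1, hV w.2⟩ ((φ.φV w.1).pullback ⋙ F')).comp
        (pi1Map (φ.restrict K H hV hE).pullbackFunctor ((𝒢'.restrict K).ρ w ⋙ F')) := by
  -- `pi1Map (Q ⋙ P) F = (pi1Map Q (P ⋙ F)).comp (pi1Map P F)` holds by `rfl`
  exact φ.pi1Map_pullbackFunctor_comp_restrictFunctor K H hV hE w F'

end Hom

end SemiGraphOfAnabelioids

end Literature.AnabelianGeometry.SemiGraphs
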